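import Literature.NumberTheory.QuadraticFields.ThreeTorsionMeanProgressionTwist
import HarnessLib

/-!
# Character sums over fundamental discriminants and the twisted form of Taniguchi–Thorne, Thm 6 (proofs)

Theorems-only companion (no definition, no named fact, no instance; D-0026) of
`Literature.NumberTheory.QuadraticFields.ThreeTorsionMean` (`tt_threeTorsion_sum_progression`,
Taniguchi–Thorne 2013, Thm 6), continuing `ThreeTorsionMeanProgressionTwist.lean` (orthogonality;
"twisted two-term asymptotics for every `χ (mod m)` ⇒ Thm 6").

Taniguchi–Thorne pass between progressions and Dirichlet characters (§6.4) and between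
`Σ #Cl₃(D)` and the count `M₃^±` of nowhere totally ramified cubic fields (§6.1:
`Σ_D #Cl₃(D) = Σ_D 1 + 2 M₃^±`, Hasse). The `Σ_D 1`-part twisted by a character `χ (mod m)` is a
character sum over fundamental discriminants; by the PROVED uniform counts in coprime classes
(`abs_card_negFundDiscrs_filter_modEq_sub_le`: `|#{D ≡ a (m)} − (3/(π² m)) Π_{p∣m}(1 − p⁻²)⁻¹ X| ≤ 18 √X`
for `m` odd, `(a, m) = 1`) it is `δ(χ) (3/π²) Π_{p ∣ m} (1 + p⁻¹)⁻¹ X + O(m √X)`. This file PROVES: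

* `sum_char_eq_sum_card_mul`, `norm_sum_char_sub_le_of_classCount` — a character sum over a finset
  of integers through its residue-class counts: uniform class counts `d + O(E)` in the coprime
  classes give `‖Σ_{D ∈ S} χ(D̄) − (Σ_{r mod m} χ(r)) d‖ ≤ m E`;
* `norm_sum_one_negFundDiscrs_sub_le`, `norm_sum_char_negFundDiscrs_le` (and `pos`) — **character
  sums over fundamental discriminants**: for `m` odd and `X ≥ 1`,
  `‖Σ_{-X<D<0} χ₀(D̄) − (3/π²) Π_{p ∣ m} (1 + p⁻¹)⁻¹ X‖ ≤ 18 m √X` (trivial character: the number of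
  imaginary quadratic fields with discriminant prime to `m`), and `‖Σ_{-X<D<0} χ(D̄)‖ ≤ 18 m √X`
  for `χ ≠ χ₀` (the twisted Lemma 21 / eq. (6.1) of the paper at level `m`);
* `twisted_two_term_iff_of_dictionary` — with the dictionary `#Cl₃ = 2c + 1`, the twisted
  two-term asymptotic for `Σ χ(D̄) #Cl₃(D)` (main term `M_t X`) is equivalent to the one for
  `Σ χ(D̄) c(D) = M₃^±(X, χ)` (main term `((M_t − M₁)/2) X`, `M₁ X` the main term of `Σ χ(D̄)`), so
  the hypotheses of `tt_threeTorsion_sum_progression_of_twisted` (Thm 25 for `M₃^±(X, χ)`) and of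
* `tt_threeTorsion_sum_progression_of_twisted_threeTorsion` — **Thm 6 from the twisted two-term
  asymptotics for `Σ_{0<±D<X} χ(D̄) #Cl₃(D)` itself** (main term `δ(χ) ((3 + C^±)/π²) Π_{p ∣ m} (1 + p⁻¹)⁻¹ X`,
  i.e. `6/π²`, `4/π²`; no auxiliary count `c`, no class field theory in the hypotheses) —
  are interchangeable.

## References

* T. Taniguchi, F. Thorne, *Secondary terms in counting functions for cubic fields*, Duke Math.
  J. 162 (2013) 2451–2508 = arXiv:1102.2914, Thm 6, §6.1 (eq. (6.1)), §6.4, Thm 25, §6.6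
  [TaniguchiThorne2013].

## Mathlib search

`Finset.sum_fiberwise'`, `MulChar.map_nonunit`, `MulChar.sum_eq_zero_of_ne_one`,
`MulChar.sum_one_eq_card_units`, `ZMod.card_units_eq_totient`, `ZMod.val_coe_unit_coprime`,
`ZMod.natCast_zmod_val`, `DirichletCharacter.norm_le_one`.
-/

noncomputable section

open Finset

namespace Literature.NumberTheory.QuadraticFields

/-! ### A character sum through residue-class counts -/

/-- `Σ_{D ∈ S} χ(D̄) = Σ_{r mod m} #{D ∈ S : D̄ = r} · χ(r)`. [folklore] -/
theorem sum_char_eq_sum_card_mul {m : ℕ} [NeZero m] (S : Finset ℤ)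
    (χ : DirichletCharacter ℂ m) :
    ∑ D ∈ S, χ (D : ZMod m) =
      ∑ r : ZMod m, ((S.filter (fun D : ℤ => (D : ZMod m) = r)).card : ℂ) * χ r := by
  rw [← Finset.sum_fiberwise' S (fun D : ℤ => (D : ZMod m)) (fun r => χ r)]
  refine Finset.sum_congr rfl fun r _ => ?_
  rw [Finset.sum_const, nsmul_eq_mul]

/-- The fibre of `S` over a residue `r (mod m)` is the progression of its representative
`r.val ∈ [0, m)`. [folklore] -/
theorem filter_coe_eq_eq_filter_modEq {m : ℕ} [NeZero m] (S : Finset ℤ) (r : ZMod m) :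
    S.filter (fun D : ℤ => (D : ZMod m) = r) = S.filter (fun D => D ≡ (r.val : ℤ) [ZMOD m]) := by
  refine Finset.filter_congr fun D _ => ?_
  rw [← ZMod.intCast_eq_intCast_iff, Int.cast_natCast, ZMod.natCast_zmod_val]

/-- A unit residue has a representative prime to `m`. [folklore] -/
theorem gcd_val_eq_one_of_isUnit {m : ℕ} [NeZero m] {r : ZMod m} (hr : IsUnit r) :
    Int.gcd (r.val : ℤ) m = 1 := by
  rw [Int.gcd_natCast_natCast]
  have h := ZMod.val_coe_unit_coprime hr.unit
  rwa [IsUnit.unit_spec] at h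

/-- **Character sums from uniform class counts.** If `|#{D ∈ S : D ≡ a (mod m)} − d| ≤ E` for
every `a` prime to `m`, then for every Dirichlet character `χ (mod m)`,
`‖Σ_{D ∈ S} χ(D̄) − (Σ_{r mod m} χ(r)) · d‖ ≤ m E` (`χ` vanishes off the units and `|χ| ≤ 1` on
them). [folklore] -/
theorem norm_sum_char_sub_le_of_classCount {m : ℕ} [NeZero m] (S : Finset ℤ) {d E : ℝ}
    (hS : ∀ a : ℤ, Int.gcd a m = 1 → |((S.filter (fun D => D ≡ a [ZMOD m])).card : ℝ) - d| ≤ E)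
    (χ : DirichletCharacter ℂ m) :
    ‖(∑ D ∈ S, χ (D : ZMod m)) - (∑ r : ZMod m, χ r) * (d : ℂ)‖ ≤ m * E := by
  have hE : 0 ≤ E := (abs_nonneg _).trans (hS 1 (by simp))
  rw [sum_char_eq_sum_card_mul, Finset.sum_mul, ← Finset.sum_sub_distrib]
  have hterm : ∀ r : ZMod m,
      ‖((S.filter (fun D : ℤ => (D : ZMod m) = r)).card : ℂ) * χ r - χ r * (d : ℂ)‖ ≤ E := by
    intro r
    by_cases hr : IsUnit r
    · have hcnt := hS (r.val : ℤ) (gcd_val_eq_one_of_isUnit hr)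
      rw [← filter_coe_eq_eq_filter_modEq] at hcnt
      have : ((S.filter (fun D : ℤ => (D : ZMod m) = r)).card : ℂ) * χ r - χ r * (d : ℂ)
          = ((((S.filter (fun D : ℤ => (D : ZMod m) = r)).card : ℝ) - d : ℝ) : ℂ) * χ r := by
        push_cast
        ring
      rw [this, norm_mul, Complex.norm_real, Real.norm_eq_abs]
      calc |(((S.filter (fun D : ℤ => (D : ZMod m) = r)).card : ℝ)) - d| * ‖χ r‖ ≤ E * 1 :=
            mul_le_mul hcnt (DirichletCharacter.norm_le_one χ r) (norm_nonneg _) hE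
        _ = E := mul_one E
    · rw [MulChar.map_nonunit χ hr, mul_zero, zero_mul, sub_zero, norm_zero]
      exact hE
  calc ‖∑ r : ZMod m, (((S.filter (fun D : ℤ => (D : ZMod m) = r)).card : ℂ) * χ r - χ r * (d : ℂ))‖
      ≤ ∑ r : ZMod m, ‖((S.filter (fun D : ℤ => (D : ZMod m) = r)).card : ℂ) * χ r - χ r * (d : ℂ)‖ :=
        norm_sum_le _ _
    _ ≤ ∑ _r : ZMod m, E := Finset.sum_le_sum fun r _ => hterm r
    _ = m * E := by rw [Finset.sum_const, Finset.card_univ, ZMod.card, nsmul_eq_mul]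

/-! ### Character sums over fundamental discriminants (`Σ_D χ(D)`, §6.1/§6.4 at level `m`) -/

/-- The main-term identity `φ(m) · (3/(π² m)) Π_{p ∣ m} (1 − p⁻²)⁻¹ = (3/π²) Π_{p ∣ m} (1 + p⁻¹)⁻¹`
(Euler's product for `φ`; cf. `totient_inv_mul_prod_eq`), with a general numerator `κ`.
[folklore] -/
theorem totient_mul_density_eq {m : ℕ} (hm : m ≠ 0) (κ x : ℝ) :
    (m.totient : ℝ) * (κ / (Real.pi ^ 2 * m) * (∏ p ∈ m.primeFactors, (1 - 1 / (p : ℝ) ^ 2)⁻¹) * x)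
      = κ / Real.pi ^ 2 * (∏ p ∈ m.primeFactors, (1 + 1 / (p : ℝ))⁻¹) * x := by
  have h := totient_inv_mul_prod_eq hm
  have hφ : (m.totient : ℝ) ≠ 0 := by
    exact_mod_cast (Nat.totient_pos.2 (Nat.pos_of_ne_zero hm)).ne'
  have hP : (∏ p ∈ m.primeFactors, (1 + 1 / (p : ℝ))⁻¹)
      = (m.totient : ℝ) * ((m : ℝ)⁻¹ * ∏ p ∈ m.primeFactors, (1 - 1 / (p : ℝ) ^ 2)⁻¹) := by
    rw [← h, ← mul_assoc, mul_inv_cancel₀ hφ, one_mul]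
  rw [hP]
  ring

/-- **Imaginary quadratic fields with discriminant prime to `m` (the trivial character).** For
`m` odd and `X ≥ 1`,
`‖Σ_{-X<D<0} χ₀(D̄) − (3/π²) Π_{p ∣ m} (1 + p⁻¹)⁻¹ X‖ ≤ 18 m √X`, `χ₀` the trivial character
`mod m` (so the sum is the number of fundamental discriminants `-X < D < 0` with `(D, m) = 1`):
the `φ(m)` coprime classes each hold `(3/(π² m)) Π (1 − p⁻²)⁻¹ X + O(√X)` of them and
`φ(m) (3/(π² m)) Π (1 − p⁻²)⁻¹ = (3/π²) Π (1 + p⁻¹)⁻¹`.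
[cite: TaniguchiThorne2013, §6.1 eq. (6.1) and §6.4 (the count of quadratic fields twisted by the trivial character)] -/
theorem norm_sum_one_negFundDiscrs_sub_le {m : ℕ} (hm : Odd m) {X : ℕ} (hX : 1 ≤ X) :
    ‖(∑ D ∈ negFundDiscrs X, (1 : DirichletCharacter ℂ m) (D : ZMod m))
        - ((3 / Real.pi ^ 2 * (∏ p ∈ m.primeFactors, (1 + 1 / (p : ℝ))⁻¹) * X : ℝ) : ℂ)‖
      ≤ 18 * m * Real.sqrt X := by
  have hm0 : m ≠ 0 := Nat.ne_of_odd_add hm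
  haveI : NeZero m := ⟨hm0⟩
  have key := norm_sum_char_sub_le_of_classCount (negFundDiscrs X)
    (fun a ha => abs_card_negFundDiscrs_filter_modEq_sub_le hm ha hX) (1 : DirichletCharacter ℂ m)
  rw [MulChar.sum_one_eq_card_units, ZMod.card_units_eq_totient] at key
  have hmain := congrArg (fun x : ℝ => (x : ℂ)) (totient_mul_density_eq hm0 3 (X : ℝ))
  push_cast at hmain key ⊢
  rw [hmain] at key
  calc _ ≤ (m : ℝ) * (18 * Real.sqrt X) := key
    _ = 18 * m * Real.sqrt X := by ring

/-- **Character sums over negative fundamental discriminants.** For `m` odd, a nontrivial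
Dirichlet character `χ (mod m)` and `X ≥ 1`, `‖Σ_{-X<D<0} χ(D̄)‖ ≤ 18 m √X` (fundamental
discriminants are uniformly distributed in the coprime classes `mod m`, and `Σ_r χ(r) = 0`).
[cite: TaniguchiThorne2013, §6.4 (twisting the count of fields by Dirichlet characters)] -/
theorem norm_sum_char_negFundDiscrs_le {m : ℕ} (hm : Odd m) {χ : DirichletCharacter ℂ m}
    (hχ : χ ≠ 1) {X : ℕ} (hX : 1 ≤ X) :
    ‖∑ D ∈ negFundDiscrs X, χ (D : ZMod m)‖ ≤ 18 * m * Real.sqrt X := by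
  have hm0 : m ≠ 0 := Nat.ne_of_odd_add hm
  haveI : NeZero m := ⟨hm0⟩
  have key := norm_sum_char_sub_le_of_classCount (negFundDiscrs X)
    (fun a ha => abs_card_negFundDiscrs_filter_modEq_sub_le hm ha hX) χ
  rw [MulChar.sum_eq_zero_of_ne_one hχ, zero_mul, sub_zero] at key
  calc _ ≤ (m : ℝ) * (18 * Real.sqrt X) := key
    _ = 18 * m * Real.sqrt X := by ring

/-- **Real quadratic fields with discriminant prime to `m` (the trivial character).** For `m`
odd and `X ≥ 1`, `‖Σ_{0<D<X} χ₀(D̄) − (3/π²) Π_{p ∣ m} (1 + p⁻¹)⁻¹ X‖ ≤ 18 m √X`.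
[cite: TaniguchiThorne2013, §6.1 eq. (6.1) and §6.4 (the count of quadratic fields twisted by the trivial character)] -/
theorem norm_sum_one_posFundDiscrs_sub_le {m : ℕ} (hm : Odd m) {X : ℕ} (hX : 1 ≤ X) :
    ‖(∑ D ∈ posFundDiscrs X, (1 : DirichletCharacter ℂ m) (D : ZMod m))
        - ((3 / Real.pi ^ 2 * (∏ p ∈ m.primeFactors, (1 + 1 / (p : ℝ))⁻¹) * X : ℝ) : ℂ)‖
      ≤ 18 * m * Real.sqrt X := by
  have hm0 : m ≠ 0 := Nat.ne_of_odd_add hm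
  haveI : NeZero m := ⟨hm0⟩
  have key := norm_sum_char_sub_le_of_classCount (posFundDiscrs X)
    (fun a ha => abs_card_posFundDiscrs_filter_modEq_sub_le hm ha hX) (1 : DirichletCharacter ℂ m)
  rw [MulChar.sum_one_eq_card_units, ZMod.card_units_eq_totient] at key
  have hmain := congrArg (fun x : ℝ => (x : ℂ)) (totient_mul_density_eq hm0 3 (X : ℝ))
  push_cast at hmain key ⊢
  rw [hmain] at key
  calc _ ≤ (m : ℝ) * (18 * Real.sqrt X) := key
    _ = 18 * m * Real.sqrt X := by ring

/-- **Character sums over positive fundamental discriminants.** For `m` odd, `χ ≠ χ₀ (mod m)`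
and `X ≥ 1`, `‖Σ_{0<D<X} χ(D̄)‖ ≤ 18 m √X`.
[cite: TaniguchiThorne2013, §6.4 (twisting the count of fields by Dirichlet characters)] -/
theorem norm_sum_char_posFundDiscrs_le {m : ℕ} (hm : Odd m) {χ : DirichletCharacter ℂ m}
    (hχ : χ ≠ 1) {X : ℕ} (hX : 1 ≤ X) :
    ‖∑ D ∈ posFundDiscrs X, χ (D : ZMod m)‖ ≤ 18 * m * Real.sqrt X := by
  have hm0 : m ≠ 0 := Nat.ne_of_odd_add hm
  haveI : NeZero m := ⟨hm0⟩
  have key := norm_sum_char_sub_le_of_classCount (posFundDiscrs X)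
    (fun a ha => abs_card_posFundDiscrs_filter_modEq_sub_le hm ha hX) χ
  rw [MulChar.sum_eq_zero_of_ne_one hχ, zero_mul, sub_zero] at key
  calc _ ≤ (m : ℝ) * (18 * Real.sqrt X) := key
    _ = 18 * m * Real.sqrt X := by ring

/-! ### Twisted sums: `Σ χ #Cl₃ = Σ χ + 2 Σ χ c` -/

/-- **Twisted form of "`Σ #Cl₃ = Σ 1 + 2 M₃`".** Let `t = 2c + 1` on the finsets `S X`, let
`χ (mod m)` be a Dirichlet character with `‖Σ_{D ∈ S X} χ(D̄) − M₁ X‖ ≤ B √X` for `X ≥ 1`, and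
`θ ≥ 1/2`. Then `Σ_{D ∈ S X} χ(D̄) t(D) = M_t X + K X^{5/6} + O_ε(X^{θ+ε})` (some `K ∈ ℂ`) iff
`Σ_{D ∈ S X} χ(D̄) c(D) = ((M_t − M₁)/2) X + K' X^{5/6} + O_ε(X^{θ+ε})` (some `K'`). With the
character sums above (`M₁ = δ(χ) (3/π²) Π_{p∣m} (1 + p⁻¹)⁻¹`, `B = 18 m`) this interchanges the
twisted two-term asymptotics for `Σ χ(D̄) #Cl₃(D)` and for `M₃^±(X, χ) = Σ χ(D̄) c(D)`
(Taniguchi–Thorne, Thm 25). [folklore] -/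
theorem twisted_two_term_iff_of_dictionary {S : ℕ → Finset ℤ} {t c : ℤ → ℕ} {m : ℕ}
    (χ : DirichletCharacter ℂ m) {Mt M₁ : ℂ} {B θ : ℝ} (hθ : 1 / 2 ≤ θ)
    (htc : ∀ X : ℕ, ∀ D ∈ S X, t D = 2 * c D + 1)
    (h1 : ∀ X : ℕ, 1 ≤ X → ‖(∑ D ∈ S X, χ (D : ZMod m)) - M₁ * X‖ ≤ B * Real.sqrt X) :
    (∃ K : ℂ, ∀ ε : ℝ, 0 < ε → ∃ C : ℝ, ∀ X : ℕ, 1 ≤ X →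
      ‖(∑ D ∈ S X, χ (D : ZMod m) * (t D : ℂ)) - Mt * X
          - K * (((X : ℝ) ^ ((5 : ℝ) / 6) : ℝ) : ℂ)‖ ≤ C * (X : ℝ) ^ (θ + ε)) ↔
    (∃ K : ℂ, ∀ ε : ℝ, 0 < ε → ∃ C : ℝ, ∀ X : ℕ, 1 ≤ X →
      ‖(∑ D ∈ S X, χ (D : ZMod m) * (c D : ℂ)) - (Mt - M₁) / 2 * X
          - K * (((X : ℝ) ^ ((5 : ℝ) / 6) : ℝ) : ℂ)‖ ≤ C * (X : ℝ) ^ (θ + ε)) := by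
  -- `Σ χ t = 2 Σ χ c + Σ χ`
  have hsum : ∀ X : ℕ, (∑ D ∈ S X, χ (D : ZMod m) * (t D : ℂ)) =
      2 * (∑ D ∈ S X, χ (D : ZMod m) * (c D : ℂ)) + ∑ D ∈ S X, χ (D : ZMod m) := by
    intro X
    rw [Finset.mul_sum, ← Finset.sum_add_distrib]
    refine Finset.sum_congr rfl fun D hD => ?_
    rw [htc X D hD]
    push_cast
    ring
  -- `B √X ≤ |B| X^{θ+ε}` for `X ≥ 1`
  have hcnt : ∀ {ε : ℝ}, 0 < ε → ∀ X : ℕ, 1 ≤ X →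
      ‖(∑ D ∈ S X, χ (D : ZMod m)) - M₁ * X‖ ≤ |B| * (X : ℝ) ^ (θ + ε) := by
    intro ε hε X hX
    have hX1 : (1 : ℝ) ≤ X := by exact_mod_cast hX
    refine (h1 X hX).trans ?_
    have h2 : Real.sqrt X ≤ (X : ℝ) ^ (θ + ε) := by
      rw [Real.sqrt_eq_rpow]
      exact Real.rpow_le_rpow_of_exponent_le hX1 (by linarith)
    calc B * Real.sqrt X ≤ |B| * Real.sqrt X :=
          mul_le_mul_of_nonneg_right (le_abs_self B) (Real.sqrt_nonneg _)
      _ ≤ |B| * (X : ℝ) ^ (θ + ε) := mul_le_mul_of_nonneg_left h2 (abs_nonneg B)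
  constructor
  · rintro ⟨K, hK⟩
    refine ⟨K / 2, fun ε hε => ?_⟩
    obtain ⟨C, hC⟩ := hK ε hε
    refine ⟨(C + |B|) / 2, fun X hX => ?_⟩
    have e1 := hC X hX
    have e2 := hcnt hε X hX
    rw [hsum X] at e1
    have key : (∑ D ∈ S X, χ (D : ZMod m) * (c D : ℂ)) - (Mt - M₁) / 2 * X
        - K / 2 * (((X : ℝ) ^ ((5 : ℝ) / 6) : ℝ) : ℂ)
        = ((2 * (∑ D ∈ S X, χ (D : ZMod m) * (c D : ℂ)) + (∑ D ∈ S X, χ (D : ZMod m))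
            - Mt * X - K * (((X : ℝ) ^ ((5 : ℝ) / 6) : ℝ) : ℂ))
          - ((∑ D ∈ S X, χ (D : ZMod m)) - M₁ * X)) / 2 := by
      ring
    rw [key, norm_div, Complex.norm_two, div_le_iff₀ (by norm_num : (0 : ℝ) < 2)]
    have e4 := (norm_sub_le _ _).trans (add_le_add e1 e2)
    linarith
  · rintro ⟨K, hK⟩
    refine ⟨2 * K, fun ε hε => ?_⟩
    obtain ⟨C, hC⟩ := hK ε hε
    refine ⟨2 * C + |B|, fun X hX => ?_⟩
    have e1 := hC X hX
    have e2 := hcnt hε X hX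
    rw [hsum X]
    have key : 2 * (∑ D ∈ S X, χ (D : ZMod m) * (c D : ℂ)) + (∑ D ∈ S X, χ (D : ZMod m))
        - Mt * X - 2 * K * (((X : ℝ) ^ ((5 : ℝ) / 6) : ℝ) : ℂ) =
        2 * ((∑ D ∈ S X, χ (D : ZMod m) * (c D : ℂ)) - (Mt - M₁) / 2 * X
            - K * (((X : ℝ) ^ ((5 : ℝ) / 6) : ℝ) : ℂ))
          + ((∑ D ∈ S X, χ (D : ZMod m)) - M₁ * X) := by
      ring
    rw [key]
    refine (norm_add_le _ _).trans ?_
    rw [norm_mul, Complex.norm_two]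
    linarith

/-! ### Thm 6 from twisted two-term asymptotics for `Σ χ(D) #Cl₃(D)` -/

/-- **Thm 6 from the character-twisted 3-torsion sums.** Assume, for every modulus `m` prime
to `6` and both signs, two-term asymptotics for `Σ_{0<±D<X} χ(D̄) #Cl₃(D)`, `χ (mod m)`:
main term `((3 + C^±)/π²) Π_{p ∣ m} (1 + p⁻¹)⁻¹ X` (`6/π²`, `4/π²`) for the trivial character,
none for `χ ≠ χ₀`, a term `K_χ X^{5/6}`, and error `O_{m,ε}(X^{18/23+ε})` — in the paper this
is Thm 25 for `M₃^±(X, χ)` plus the twisted count of quadratic fields (§6.1: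
`Σ χ #Cl₃ = Σ χ + 2 M₃^±(X, χ)`; cf. `twisted_two_term_iff_of_dictionary` and
`norm_sum_one_negFundDiscrs_sub_le`). Then `tt_threeTorsion_sum_progression` holds: by
orthogonality (`two_term_progression_of_twisted`) and
`φ(m)⁻¹ Π_{p∣m} (1 + p⁻¹)⁻¹ = m⁻¹ Π_{p∣m} (1 − p⁻²)⁻¹` (`totient_inv_mul_prod_eq`). The hypotheses
(twisted Shintani zeta functions) are not in the tree.
[cite: TaniguchiThorne2013, §6.6 (deduction of Theorem 6 from Theorem 25)] -/
theorem tt_threeTorsion_sum_progression_of_twisted_threeTorsion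
    (hneg1 : ∀ m : ℕ, m.Coprime 6 → ∃ K : ℂ, ∀ ε : ℝ, 0 < ε → ∃ C : ℝ, ∀ X : ℕ, 1 ≤ X →
      ‖(∑ D ∈ negFundDiscrs X,
          (1 : DirichletCharacter ℂ m) (D : ZMod m) * (quadFieldThreeTorsion D : ℂ))
          - ((6 / Real.pi ^ 2 * (∏ p ∈ m.primeFactors, (1 + 1 / (p : ℝ))⁻¹) * X : ℝ) : ℂ)
          - K * (((X : ℝ) ^ ((5 : ℝ) / 6) : ℝ) : ℂ)‖ ≤ C * (X : ℝ) ^ ((18 : ℝ) / 23 + ε))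
    (hneg : ∀ m : ℕ, m.Coprime 6 → ∀ χ : DirichletCharacter ℂ m, χ ≠ 1 → ∃ K : ℂ, ∀ ε : ℝ,
      0 < ε → ∃ C : ℝ, ∀ X : ℕ, 1 ≤ X →
        ‖(∑ D ∈ negFundDiscrs X, χ (D : ZMod m) * (quadFieldThreeTorsion D : ℂ))
            - K * (((X : ℝ) ^ ((5 : ℝ) / 6) : ℝ) : ℂ)‖ ≤ C * (X : ℝ) ^ ((18 : ℝ) / 23 + ε))
    (hpos1 : ∀ m : ℕ, m.Coprime 6 → ∃ K : ℂ, ∀ ε : ℝ, 0 < ε → ∃ C : ℝ, ∀ X : ℕ, 1 ≤ X →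
      ‖(∑ D ∈ posFundDiscrs X,
          (1 : DirichletCharacter ℂ m) (D : ZMod m) * (quadFieldThreeTorsion D : ℂ))
          - ((4 / Real.pi ^ 2 * (∏ p ∈ m.primeFactors, (1 + 1 / (p : ℝ))⁻¹) * X : ℝ) : ℂ)
          - K * (((X : ℝ) ^ ((5 : ℝ) / 6) : ℝ) : ℂ)‖ ≤ C * (X : ℝ) ^ ((18 : ℝ) / 23 + ε))
    (hpos : ∀ m : ℕ, m.Coprime 6 → ∀ χ : DirichletCharacter ℂ m, χ ≠ 1 → ∃ K : ℂ, ∀ ε : ℝ,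
      0 < ε → ∃ C : ℝ, ∀ X : ℕ, 1 ≤ X →
        ‖(∑ D ∈ posFundDiscrs X, χ (D : ZMod m) * (quadFieldThreeTorsion D : ℂ))
            - K * (((X : ℝ) ^ ((5 : ℝ) / 6) : ℝ) : ℂ)‖ ≤ C * (X : ℝ) ^ ((18 : ℝ) / 23 + ε)) :
    tt_threeTorsion_sum_progression := by
  intro m a _ h
  have hm0 : m ≠ 0 := Nat.ne_of_odd_add (odd_and_gcd_eq_one_of_gcd_six_mul h).1
  haveI : NeZero m := ⟨hm0⟩
  have hm6 : m.Coprime 6 := coprime_six_of_gcd_six_mul h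
  have ha : IsCoprime a m :=
    Int.isCoprime_iff_gcd_eq_one.2 (odd_and_gcd_eq_one_of_gcd_six_mul h).2
  -- the constants `((3 + C^±)/π²) Π₊ / φ(m) = ((3 + C^±)/(π² m)) Π₋`
  have hconst : ∀ κ : ℝ, κ / Real.pi ^ 2 * (∏ p ∈ m.primeFactors, (1 + 1 / (p : ℝ))⁻¹)
      / (m.totient : ℝ) = κ / (Real.pi ^ 2 * m) * ∏ p ∈ m.primeFactors, (1 - 1 / (p : ℝ) ^ 2)⁻¹ := by
    intro κ
    calc κ / Real.pi ^ 2 * (∏ p ∈ m.primeFactors, (1 + 1 / (p : ℝ))⁻¹) / (m.totient : ℝ)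
        = κ / Real.pi ^ 2 *
            ((m.totient : ℝ)⁻¹ * ∏ p ∈ m.primeFactors, (1 + 1 / (p : ℝ))⁻¹) := by ring
      _ = κ / Real.pi ^ 2 *
            ((m : ℝ)⁻¹ * ∏ p ∈ m.primeFactors, (1 - 1 / (p : ℝ) ^ 2)⁻¹) := by
          rw [totient_inv_mul_prod_eq hm0]
      _ = κ / (Real.pi ^ 2 * m) * ∏ p ∈ m.primeFactors, (1 - 1 / (p : ℝ) ^ 2)⁻¹ := by ring
  constructor
  · have key := two_term_progression_of_twisted (S := negFundDiscrs)
      (w := fun D => (quadFieldThreeTorsion D : ℝ)) (θ := (18 : ℝ) / 23) ha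
      (by simpa only [Complex.ofReal_natCast] using hneg1 m hm6)
      (by simpa only [Complex.ofReal_natCast] using hneg m hm6)
    obtain ⟨K, hK⟩ := key
    refine ⟨K, fun ε hε => ?_⟩
    obtain ⟨C, hC⟩ := hK ε hε
    refine ⟨C, fun X hX => ?_⟩
    have := hC X hX
    rwa [hconst 6] at this
  · have key := two_term_progression_of_twisted (S := posFundDiscrs)
      (w := fun D => (quadFieldThreeTorsion D : ℝ)) (θ := (18 : ℝ) / 23) ha
      (by simpa only [Complex.ofReal_natCast] using hpos1 m hm6)
      (by simpa only [Complex.ofReal_natCast] using hpos m hm6)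
    obtain ⟨K, hK⟩ := key
    refine ⟨K, fun ε hε => ?_⟩
    obtain ⟨C, hC⟩ := hK ε hε
    refine ⟨C, fun X hX => ?_⟩
    have := hC X hX
    rwa [hconst 4] at this

end Literature.NumberTheory.QuadraticFields

end
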